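import Mathlib
import Summits.MatrixMultiplication.MatrixMultiplication.Theorems.FidelityWitnessesFidelityGapThreeSeventeenStubBorelFixedApolarityTransport

/-!
# Borel-fixed border apolarity at `(⟨3,3,3⟩, 17)` — part 7: the stabiliser acts on Slip limits

Crux `stmt-MatrixMultiplication-4958` (`FidelityWitnesses.FidelityGapThreeSeventeen`), line
`punctual-saturation`, stub `stub_borelFixedApolarity` (helper file for the Borel normal form half).

The substitution `borelSubst P Q R` of the line's vocabulary (the action of `(P, Q, R) ∈ GL₃³` on
`C ⊕ A ⊕ B` by `(c, a, b) ↦ (P⁻ᵀ c R⁻ᵀ, P a Q, Q⁻¹ b R)`, pulled back to the Cox ring) is the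
substitution of an explicit SLOT-PRESERVING matrix (`BorelAct.borelVar_eq_subst`), and for invertible
`P, Q, R` the matrices of `(P, Q, R)` and `(P⁻¹, Q⁻¹, R⁻¹)` are inverse to each other
(`BorelAct.bmat_mul_bmat_inv`, `BorelAct.bmat_inv_mul_bmat`); more generally the action is a GROUP
ACTION on the Cox ring: `borelSubst P Q R ∘ borelSubst P' Q' R' = borelSubst (P' P) (Q Q') (R R')`,
`borelSubst 1 1 1 = id` (`BorelAct.borelSubst_comp`, `BorelAct.borelSubst_one`; needed to pass from the
torus and the root subgroups to the whole Borel subgroup).  By part 6, **Slip limits are carried to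
Slip limits by every `borelSubst P Q R` with `P, Q, R` invertible** (`stub_borelFixedApolarity_borelAct`):
the orbit of a Slip limit under the stabiliser consists of Slip limits — the equivariance half of the
Borel normal form for `IsSlipLimit` (Buczyńska–Buczyński 2021 Thm 4.3; CHL 2023 §2.4).
Elementary matrix algebra; everything proved.
-/

noncomputable section

namespace Summit.MatrixMultiplication.MatrixMultiplication.Theorems.PunctualSaturation

-- single-conjunct summit: the `Summit.<S>.<P>` prefix repeats `MatrixMultiplication` by design (D-0017)
set_option linter.dupNamespace false

open scoped BigOperators
open MvPolynomial

namespace BorelAct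

/-- The matrix of the point action of `(P, Q, R)`: entry `(v, v')` is the coefficient of `X_{v'}` in
`borelVar P Q R v`. Written `bm[P, Q, R]`. [folklore] -/
local notation3 "bm[" P ", " Q ", " R "]" => fun (v v' : Var) =>
  if v.1 = v'.1 then
    ![(P⁻¹ : Matrix (Fin 3) (Fin 3) ℂ) v'.2.1 v.2.1 * (R⁻¹ : Matrix (Fin 3) (Fin 3) ℂ) v.2.2 v'.2.2,
      (P : Matrix (Fin 3) (Fin 3) ℂ) v.2.1 v'.2.1 * (Q : Matrix (Fin 3) (Fin 3) ℂ) v'.2.2 v.2.2,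
      (Q⁻¹ : Matrix (Fin 3) (Fin 3) ℂ) v.2.1 v'.2.1 * (R : Matrix (Fin 3) (Fin 3) ℂ) v'.2.2 v.2.2] v.1
  else (0 : ℂ)

variable (P Q R : Matrix (Fin 3) (Fin 3) ℂ)

/-- Sums over the variables, slot by slot. [folklore] -/
theorem sum_var {M : Type*} [AddCommMonoid M] (F : Var → M) :
    ∑ v, F v = ∑ s : Fin 3, ∑ i : Fin 3, ∑ j : Fin 3, F (s, i, j) := by
  rw [Fintype.sum_prod_type]
  refine Finset.sum_congr rfl fun s _ => ?_
  rw [Fintype.sum_prod_type]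

/-- **`borelVar` is the substitution of the matrix `bm[P, Q, R]`.** [folklore] -/
theorem borelVar_eq_subst :
    borelVar P Q R = fun v => ∑ v', C (bm[P, Q, R] v v') * X v' := by
  funext v
  obtain ⟨s, i, j⟩ := v
  rw [sum_var, Finset.sum_eq_single s]
  · fin_cases s <;> simp [borelVar]
  · intro s' _ hs'
    simp [Ne.symm hs']
  · intro h; exact absurd (Finset.mem_univ s) h

/-- `bm[P, Q, R]` is slot-preserving. [folklore] -/
theorem bmat_slot (v v' : Var) (h : v.1 ≠ v'.1) : bm[P, Q, R] v v' = 0 := by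
  simp [h]

/-- A block computation: `∑_{i' j'} (A_{i i'} B_{j' j}) (C_{i' i''} D_{j'' j'}) = (AC)_{i i''} (DB)_{j'' j}`.
[folklore] -/
theorem block_sum (A B C D : Matrix (Fin 3) (Fin 3) ℂ) (i j i'' j'' : Fin 3) :
    ∑ i', ∑ j', A i i' * B j' j * (C i' i'' * D j'' j') = (A * C) i i'' * (D * B) j'' j := by
  rw [Matrix.mul_apply, Matrix.mul_apply, Finset.sum_mul_sum]
  refine Finset.sum_congr rfl fun i' _ => Finset.sum_congr rfl fun j' _ => by ring

/-- The other block computation: `∑_{i' j'} (A_{i' i} B_{j j'}) (C_{i'' i'} D_{j' j''}) = (CA)_{i'' i} (BD)_{j j''}`.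
[folklore] -/
theorem block_sum' (A B C D : Matrix (Fin 3) (Fin 3) ℂ) (i j i'' j'' : Fin 3) :
    ∑ i', ∑ j', A i' i * B j j' * (C i'' i' * D j' j'') = (C * A) i'' i * (B * D) j j'' := by
  rw [Matrix.mul_apply, Matrix.mul_apply, Finset.sum_mul_sum]
  refine Finset.sum_congr rfl fun i' _ => Finset.sum_congr rfl fun j' _ => by ring

/-- The product of the matrices of `(P, Q, R)` and `(P', Q', R')` vanishes across slots and is a block
sum within a slot. [folklore] -/
theorem sum_bmat_mul_bmat (P' Q' R' : Matrix (Fin 3) (Fin 3) ℂ) (v v'' : Var) :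
    ∑ v', bm[P, Q, R] v v' * bm[P', Q', R'] v' v'' =
      if v.1 = v''.1 then
        ∑ i', ∑ j', bm[P, Q, R] v (v.1, i', j') * bm[P', Q', R'] (v.1, i', j') v''
      else 0 := by
  rw [sum_var, Finset.sum_eq_single v.1]
  · split_ifs with h
    · rfl
    · refine Finset.sum_eq_zero fun i' _ => Finset.sum_eq_zero fun j' _ => ?_
      simp [h]
  · intro s' _ hs'
    refine Finset.sum_eq_zero fun i' _ => Finset.sum_eq_zero fun j' _ => ?_
    simp [Ne.symm hs']
  · intro h; exact absurd (Finset.mem_univ _) h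

/-- **`bm[P, Q, R] · bm[P⁻¹, Q⁻¹, R⁻¹] = 1`** for invertible `P, Q, R`. [folklore] -/
theorem bmat_mul_bmat_inv (hP : IsUnit P.det) (hQ : IsUnit Q.det) (hR : IsUnit R.det) (v v'' : Var) :
    ∑ v', bm[P, Q, R] v v' * bm[P⁻¹, Q⁻¹, R⁻¹] v' v'' = if v = v'' then 1 else 0 := by
  rw [sum_bmat_mul_bmat]
  obtain ⟨s, i, j⟩ := v
  obtain ⟨s'', i'', j''⟩ := v''
  by_cases hs : s = s''
  · subst hs
    simp only [if_true, Prod.mk.injEq, true_and]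
    fin_cases s
    · simp only [Fin.zero_eta, Fin.isValue, Matrix.cons_val_zero,
        Matrix.nonsing_inv_nonsing_inv _ hP, Matrix.nonsing_inv_nonsing_inv _ hR]
      rw [block_sum', Matrix.mul_nonsing_inv _ hP, Matrix.nonsing_inv_mul _ hR, Matrix.one_apply,
        Matrix.one_apply]
      by_cases h1 : i = i'' <;> by_cases h2 : j = j'' <;> simp [h1, h2, Ne.symm]
    · simp only [Fin.mk_one, Fin.isValue, Matrix.cons_val_one, Matrix.cons_val_zero]
      rw [block_sum, Matrix.mul_nonsing_inv _ hP, Matrix.nonsing_inv_mul _ hQ, Matrix.one_apply,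
        Matrix.one_apply]
      by_cases h1 : i = i'' <;> by_cases h2 : j = j'' <;> simp [h1, h2, Ne.symm]
    · simp only [Fin.reduceFinMk, Matrix.cons_val, Matrix.nonsing_inv_nonsing_inv _ hQ]
      rw [block_sum, Matrix.nonsing_inv_mul _ hQ, Matrix.nonsing_inv_mul _ hR, Matrix.one_apply,
        Matrix.one_apply]
      by_cases h1 : i = i'' <;> by_cases h2 : j = j'' <;> simp [h1, h2, Ne.symm]
  · rw [if_neg hs, if_neg]
    simp [hs]

/-- **`bm[P⁻¹, Q⁻¹, R⁻¹] · bm[P, Q, R] = 1`** for invertible `P, Q, R`. [folklore] -/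
theorem bmat_inv_mul_bmat (hP : IsUnit P.det) (hQ : IsUnit Q.det) (hR : IsUnit R.det) (v v'' : Var) :
    ∑ v', bm[P⁻¹, Q⁻¹, R⁻¹] v v' * bm[P, Q, R] v' v'' = if v = v'' then 1 else 0 := by
  have h := bmat_mul_bmat_inv P⁻¹ Q⁻¹ R⁻¹ (Matrix.isUnit_nonsing_inv_det _ hP)
    (Matrix.isUnit_nonsing_inv_det _ hQ) (Matrix.isUnit_nonsing_inv_det _ hR) v v''
  simpa only [Matrix.nonsing_inv_nonsing_inv _ hP, Matrix.nonsing_inv_nonsing_inv _ hQ,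
    Matrix.nonsing_inv_nonsing_inv _ hR] using h


/-! ## The group law -/

/-- Substituting `a` into the linear forms of `b` gives the linear forms of `b · a`. [folklore] -/
theorem aeval_lin_lin (a b : Var → Var → ℂ) (v : Var) :
    aeval (fun v => ∑ v', C (a v v') * X v') (∑ v', C (b v v') * X v' : S) =
      ∑ v'', C (∑ v', b v v' * a v' v'') * X v'' := by
  classical
  simp only [map_sum, map_mul, aeval_C, aeval_X, algebraMap_eq]
  simp_rw [Finset.mul_sum]
  rw [Finset.sum_comm]
  refine Finset.sum_congr rfl fun v'' _ => ?_
  rw [Finset.sum_mul]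
  refine Finset.sum_congr rfl fun v' _ => ?_
  rw [mul_assoc]

/-- Composing two matrix substitutions is the substitution of the product matrix (in the order
`b · a`). [folklore] -/
theorem subst_comp_subst (a b : Var → Var → ℂ) :
    (aeval (fun v => ∑ v', C (a v v') * X v') : S →ₐ[ℂ] S).comp
        (aeval (fun v => ∑ v', C (b v v') * X v') : S →ₐ[ℂ] S) =
      aeval (fun v => ∑ v'', C (∑ v', b v v' * a v' v'') * X v'') := by
  refine MvPolynomial.algHom_ext fun v => ?_
  rw [AlgHom.comp_apply, aeval_X, aeval_X]
  exact aeval_lin_lin a b v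

/-- The product of the matrices of `(P, Q, R)` and `(P', Q', R')` is the matrix of
`(P' P, Q Q', R R')`. [folklore] -/
theorem bmat_mul_bmat (P' Q' R' : Matrix (Fin 3) (Fin 3) ℂ) (v v'' : Var) :
    ∑ v', bm[P', Q', R'] v v' * bm[P, Q, R] v' v'' = bm[P' * P, Q * Q', R * R'] v v'' := by
  rw [sum_bmat_mul_bmat]
  obtain ⟨s, i, j⟩ := v
  obtain ⟨s'', i'', j''⟩ := v''
  by_cases hs : s = s''
  · subst hs
    simp only [if_true]
    fin_cases s
    · simp only [Fin.zero_eta, Fin.isValue, Matrix.cons_val_zero]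
      rw [block_sum', Matrix.mul_inv_rev, Matrix.mul_inv_rev]
    · simp only [Fin.mk_one, Fin.isValue, Matrix.cons_val_one, Matrix.cons_val_zero]
      rw [block_sum]
    · simp only [Fin.reduceFinMk, Matrix.cons_val]
      rw [block_sum, Matrix.mul_inv_rev]
  · rw [if_neg hs]
    simp [hs]

/-- **The group law of the action on the Cox ring**:
`borelSubst P Q R ∘ borelSubst P' Q' R' = borelSubst (P' P) (Q Q') (R R')` (contravariant in `P`,
covariant in `Q, R`, as befits a pull-back). [folklore] -/
theorem borelSubst_comp (P' Q' R' : Matrix (Fin 3) (Fin 3) ℂ) :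
    (borelSubst P Q R).comp (borelSubst P' Q' R') = borelSubst (P' * P) (Q * Q') (R * R') := by
  rw [borelSubst, borelSubst, borelSubst, borelVar_eq_subst, borelVar_eq_subst, borelVar_eq_subst,
    subst_comp_subst]
  refine MvPolynomial.algHom_ext fun v => ?_
  rw [aeval_X, aeval_X]
  exact Finset.sum_congr rfl fun v'' _ => by rw [bmat_mul_bmat]

/-- The matrix of `(1, 1, 1)` is the identity. [folklore] -/
theorem bmat_one (v v' : Var) :
    bm[(1 : Matrix (Fin 3) (Fin 3) ℂ), (1 : Matrix (Fin 3) (Fin 3) ℂ), (1 : Matrix (Fin 3) (Fin 3) ℂ)] v v' =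
      if v = v' then 1 else 0 := by
  obtain ⟨s, i, j⟩ := v
  obtain ⟨s', i', j'⟩ := v'
  dsimp only
  by_cases hs : s = s'
  · subst hs
    simp only [if_true, Prod.mk.injEq, true_and, inv_one]
    fin_cases s
    · simp only [Fin.zero_eta, Fin.isValue, Matrix.cons_val_zero, Matrix.one_apply]
      by_cases h1 : i = i' <;> by_cases h2 : j = j' <;> simp [h1, h2, Ne.symm]
    · simp only [Fin.mk_one, Fin.isValue, Matrix.cons_val_one, Matrix.cons_val_zero, Matrix.one_apply]
      by_cases h1 : i = i' <;> by_cases h2 : j = j' <;> simp [h1, h2, Ne.symm]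
    · simp only [Fin.reduceFinMk, Matrix.cons_val, Matrix.one_apply]
      by_cases h1 : i = i' <;> by_cases h2 : j = j' <;> simp [h1, h2, Ne.symm]
  · rw [if_neg hs, if_neg]
    simp [hs]

/-- The identity acts trivially. [folklore] -/
theorem borelSubst_one : borelSubst 1 1 1 = AlgHom.id ℂ S := by
  classical
  refine MvPolynomial.algHom_ext fun v => ?_
  rw [AlgHom.id_apply, borelSubst, aeval_X, borelVar_eq_subst]
  beta_reduce
  simp_rw [bmat_one, apply_ite C, C_1, C_0, ite_mul, one_mul, zero_mul]
  rw [Finset.sum_ite_eq]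
  simp

/-- **Slip witnesses are carried along by the stabiliser**: if `Γ` witnesses `I` then the transformed
configurations `bm[P⁻¹, Q⁻¹, R⁻¹] Γ` witness `borelSubst P Q R '' I`. [cite: BuczynskaBuczynski2021, Thm 4.3] -/
theorem isSlipWitness_map_borelSubst (hP : IsUnit P.det) (hQ : IsUnit Q.det) (hR : IsUnit R.det)
    {I : Ideal S} {Γ : ℕ → Config} (hΓ : IsSlipWitness I Γ) :
    IsSlipWitness (I.map (borelSubst P Q R))
      (fun k ρ v => ∑ v', bm[P⁻¹, Q⁻¹, R⁻¹] v v' * Γ k ρ v') := by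
  have h := Transport.isSlipWitness_map (bm[P⁻¹, Q⁻¹, R⁻¹]) (bm[P, Q, R])
    (fun v v' hv => bmat_slot P⁻¹ Q⁻¹ R⁻¹ v v' hv) (fun v v' hv => bmat_slot P Q R v v' hv)
    (bmat_inv_mul_bmat P Q R hP hQ hR) (bmat_mul_bmat_inv P Q R hP hQ hR) hΓ
  have hsub : (aeval (fun v => ∑ v', C (bm[P, Q, R] v v') * X v') : S →ₐ[ℂ] S) = borelSubst P Q R := by
    rw [borelSubst, borelVar_eq_subst]
  rwa [hsub] at h

end BorelAct

/-- **Registered sub-goal `stub_borelFixedApolarity_borelAct` of `stub_borelFixedApolarity`**: the image of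
a Slip limit under `borelSubst P Q R` (`P, Q, R` invertible — in particular for the Borel subgroup) is a
Slip limit. [cite: BuczynskaBuczynski2021, Thm 4.3] -/
theorem stub_borelFixedApolarity_borelAct :
    ∀ (P Q R : Matrix (Fin 3) (Fin 3) ℂ), IsUnit P.det → IsUnit Q.det → IsUnit R.det →
      ∀ I : Ideal S, IsSlipLimit I → IsSlipLimit (I.map (borelSubst P Q R)) :=
  fun P Q R hP hQ hR _ ⟨_, hΓ⟩ => ⟨_, BorelAct.isSlipWitness_map_borelSubst P Q R hP hQ hR hΓ⟩

end Summit.MatrixMultiplication.MatrixMultiplication.Theorems.PunctualSaturation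

end
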